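import Summits.QuantumFields.YangMills.Theorems.SwapVirialDeficitGnomonicJetFourDeficit
import Summits.QuantumFields.YangMills.Theorems.SwapVirialDeficitBlowUpGnomonicDeficitDefs
import Mathlib.Analysis.Calculus.MeanValue
import HarnessLib

/-!
# W4 (order-4 jets), part K6: THE ORDER-4 TAYLOR DATUM OF THE σ-GLUED DEFICIT ALONG THE EULER RAYS — `A₃ = 2484000·L⁴`, `A₄ = 381240000·L⁴`
# (free-hands support of ⟨stmt-QuantumFields-24197⟩ `SwapVirialDeficit.SwapGluedStiffness`)

LEAD g97's brick W4 (HOME `sfw-p2-g97-memo-24197-steep-window-morse-bott.md` §1 (B-bulk)): «jets `|∂_t³ F̂(p, t·y)| ≤ A₃‖y‖³`, `|∂_t⁴| ≤ A₄‖y‖⁴`,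
`A₃, A₄ = poly(L)`» for w2 g58's ✓`laplaceMethod_quantitative_fibred_of_taylor` (fibre `y` = the Euler-dilated gnomonic coordinates, base `p` = hub, signs,
axial parts; the ray `t ↦ F̂(p, t·y)` is `t ↦ chartDeficit L z χ (blowUpPoint t (gnomonicPoint a ε η)) = gnoDeficit z χ a ε (eulerDilate t η)`,
✓`blowUpPoint_gnomonicPoint` ∕ ✓`gnoDeficit_eulerDilate`).  Parts K1–K5 (✓`…GnomonicJetFour` ∕ `…JetFourLetters` ∕ `…JetFourLeaders` ∕ `…JetFourWords` ∕
`…JetFourDeficit`) give four derivative witnesses with `|φ′| ≤ 720L⁴A`, `|φ″| ≤ 20400L⁴A²`, `|φ‴| ≤ 2484000L⁴A³`, `|φ⁗| ≤ 381240000L⁴A⁴` when every letter size is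
`≤ A` (sup-type size; leaders ≤ 3A, followers ≤ A, links ≤ 5A).  Here:
* §1 (Mathlib only) ★★ `abs_taylor_four_remainder_le` — for any real `φ` with four derivative witnesses on `ℝ` and `|φ⁗| ≤ M` on `[0,1]`:
  `|φ 1 − φ 0 − φ′ 0 − φ″ 0/2 − φ‴ 0/6| ≤ M/6` (the classical trick `G(s) = φ(1) − Σ_{k≤3} φ⁽ᵏ⁾(s)(1−s)ᵏ/k!`, `G′ = −φ⁗(s)(1−s)³/6`, mean value inequality;
  the sharp `M/24` is not needed); ★★ `abs_taylor_three_remainder_le` — `|φ 1 − φ 0 − φ′ 0 − φ″ 0/2| ≤ M₃/2` (the CUBIC datum of w2 g58's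
  ✓`laplaceMethod_quantitative_cubic`, `1/√b` rate — ORDER 3 SUFFICES for the steep window; the quartic datum serves the `1/b` core);
  ★ `iteratedDeriv_eq_of_hasDerivAt_chain` — the witnesses ARE `deriv φ`, `iteratedDeriv 2∕3∕4 φ`;
* §2 ★★★ `taylor_four_chartDeficit_gnomonic` — THE W4 DATUM: for hub `a ≠ 0`, all letter sizes `≤ A`, and `φ t = chartDeficit L z χ (blowUpPoint t (gnomonicPoint a ε η))`:
  `∀ t, |deriv φ t| ≤ 720L⁴A ∧ |iteratedDeriv 2 φ t| ≤ 20400L⁴A² ∧ |iteratedDeriv 3 φ t| ≤ 2484000L⁴A³ ∧ |iteratedDeriv 4 φ t| ≤ 381240000L⁴A⁴`, and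
  `|φ 1 − φ 0 − deriv φ 0 − iteratedDeriv 2 φ 0/2| ≤ 2484000L⁴A³/2`, `|φ 1 − φ 0 − deriv φ 0 − iteratedDeriv 2 φ 0/2 − iteratedDeriv 3 φ 0/6| ≤ 381240000L⁴A⁴/6`;
  ★★ `taylor_four_gnoDeficit` — the same read on
  `F̂(eulerDilate t η)`.  The cubic coefficient `τ(y) = iteratedDeriv 3 φ_y 0 / 6` is odd under `y ↦ −y` (`φ_{−y}(t) = φ_y(−t)`); that symmetry lives with the
  fibre∕base split (W3) and is not restated here.

HONEST LABEL: pointwise calculus with explicit polynomial constants; no estimate on the ring's Gibbs state; nothing about ⟨24197⟩ (window-uniform, OPEN), (LW), (M),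
W3∕W5–W9 or any rung is proved; ⟨24194⟩ ∕ ⟨24196⟩ ∕ ⟨24497⟩ OPEN; item of record ⟨24085⟩ SubOctaveBounded aside ∕ untouched; the Yang–Mills mass gap is NOT proved;
no summit is proved by a line.  THEOREMS ONLY (0 `def`, 0 `sorry`), standard axioms, no local instances.  Seat ym-line-fcl-p3 g47 (cell ym-idea-1, free hands),
`--supports stmt-QuantumFields-24197`.  References: [cite: Luscher1983, §2]; [folklore] (Taylor's theorem).
-/

set_option autoImplicit false
set_option synthInstance.maxSize 1024

noncomputable section

open Quaternion Set
open scoped Quaternion BigOperators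
open Literature.MathematicalPhysics.QuantumLattice
open Literature.MathematicalPhysics.QuantumFieldTheory hiding SU2
open Summit.QuantumFields.YangMills.Theorems.FemtoTransferGap
open Summit.QuantumFields.YangMills.Theorems.FemtoTransferGap.TT
open Summit.QuantumFields.YangMills.Theorems.SwapVirialDeficit.BlowUpRing

namespace Summit.QuantumFields.YangMills.Theorems.SwapVirialDeficit.Gnomonic

/-! ## §1 The fourth-order Taylor remainder and the identification of the witnesses -/

/-- ★★ **FOURTH-ORDER TAYLOR REMAINDER** (crude constant): if `φ` has derivative witnesses `φ₁, φ₂, φ₃, φ₄` on `ℝ` and `|φ₄| ≤ M` on `[0,1]`, then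
`|φ 1 − φ 0 − φ₁ 0 − φ₂ 0/2 − φ₃ 0/6| ≤ M/6` (`G(s) = φ 1 − Σ_{k≤3} φₖ(s)(1−s)ᵏ/k!` has `G′(s) = −φ₄(s)(1−s)³/6`, `G(1) = 0`; mean value inequality). [folklore] -/
theorem abs_taylor_four_remainder_le {φ φ₁ φ₂ φ₃ φ₄ : ℝ → ℝ} {M : ℝ} (h1 : ∀ t, HasDerivAt φ (φ₁ t) t) (h2 : ∀ t, HasDerivAt φ₁ (φ₂ t) t)
    (h3 : ∀ t, HasDerivAt φ₂ (φ₃ t) t) (h4 : ∀ t, HasDerivAt φ₃ (φ₄ t) t) (hM : ∀ t ∈ Icc (0 : ℝ) 1, |φ₄ t| ≤ M) :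
    |φ 1 - φ 0 - φ₁ 0 - φ₂ 0 / 2 - φ₃ 0 / 6| ≤ M / 6 := by
  have hM0 : 0 ≤ M := (abs_nonneg _).trans (hM 0 (by simp))
  -- the auxiliary function and its derivative
  have hG : ∀ s, HasDerivAt (fun s => φ 1 - (φ s + φ₁ s * (1 - s) + φ₂ s * (1 - s) ^ 2 / 2 + φ₃ s * (1 - s) ^ 3 / 6))
      (-(φ₄ s * (1 - s) ^ 3 / 6)) s := by
    intro s
    have hl : HasDerivAt (fun s : ℝ => 1 - s) (-1) s := (hasDerivAt_id' s).const_sub 1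
    have hq2 : HasDerivAt (fun s : ℝ => (1 - s) ^ 2) (-(2 * (1 - s))) s := (hl.pow 2).congr_deriv (by norm_num)
    have hq3 : HasDerivAt (fun s : ℝ => (1 - s) ^ 3) (-(3 * (1 - s) ^ 2)) s := (hl.pow 3).congr_deriv (by norm_num)
    have h := ((((h1 s).add ((h2 s).mul hl)).add (((h3 s).mul hq2).div_const 2)).add (((h4 s).mul hq3).div_const 6)).const_sub (φ 1)
    refine h.congr_deriv ?_
    ring
  have hGw : ∀ s ∈ Icc (0 : ℝ) 1, HasDerivWithinAt (fun s => φ 1 - (φ s + φ₁ s * (1 - s) + φ₂ s * (1 - s) ^ 2 / 2 + φ₃ s * (1 - s) ^ 3 / 6))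
      (-(φ₄ s * (1 - s) ^ 3 / 6)) (Icc (0 : ℝ) 1) s := fun s _ => (hG s).hasDerivWithinAt
  have hbound : ∀ s ∈ Icc (0 : ℝ) 1, ‖-(φ₄ s * (1 - s) ^ 3 / 6)‖ ≤ M / 6 := by
    intro s hs
    have h1s : 0 ≤ 1 - s := by linarith [hs.2]
    have hp : (1 - s) ^ 3 ≤ 1 := pow_le_one₀ h1s (by linarith [hs.1])
    have hp0 : 0 ≤ (1 - s) ^ 3 := pow_nonneg h1s 3
    have hφ := hM s hs
    rw [Real.norm_eq_abs, abs_neg, abs_div, abs_mul, abs_of_nonneg hp0, abs_of_pos (by norm_num : (0 : ℝ) < 6)]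
    have : |φ₄ s| * (1 - s) ^ 3 ≤ M * 1 := mul_le_mul hφ hp hp0 hM0
    linarith
  have hmv := (convex_Icc (0 : ℝ) 1).norm_image_sub_le_of_norm_hasDerivWithin_le hGw hbound (right_mem_Icc.2 zero_le_one) (left_mem_Icc.2 zero_le_one)
  have e : |φ 1 - φ 0 - φ₁ 0 - φ₂ 0 / 2 - φ₃ 0 / 6| =
      ‖(φ 1 - (φ 0 + φ₁ 0 * (1 - 0) + φ₂ 0 * (1 - 0) ^ 2 / 2 + φ₃ 0 * (1 - 0) ^ 3 / 6)) -
        (φ 1 - (φ 1 + φ₁ 1 * (1 - 1) + φ₂ 1 * (1 - 1) ^ 2 / 2 + φ₃ 1 * (1 - 1) ^ 3 / 6))‖ := by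
    rw [Real.norm_eq_abs]; congr 1; ring
  rw [e]
  refine hmv.trans ?_
  simp

/-- ★★ **THIRD-ORDER TAYLOR REMAINDER** (the CUBIC datum of w2 g58's ✓`laplaceMethod_quantitative_cubic`): if `φ` has derivative witnesses `φ₁, φ₂, φ₃` on `ℝ`
and `|φ₃| ≤ M` on `[0,1]`, then `|φ 1 − φ 0 − φ₁ 0 − φ₂ 0/2| ≤ M/2` (`G(s) = φ 1 − (φ s + φ₁ s (1−s) + φ₂ s (1−s)²/2)`, `G′ = −φ₃(s)(1−s)²/2`). [folklore] -/
theorem abs_taylor_three_remainder_le {φ φ₁ φ₂ φ₃ : ℝ → ℝ} {M : ℝ} (h1 : ∀ t, HasDerivAt φ (φ₁ t) t) (h2 : ∀ t, HasDerivAt φ₁ (φ₂ t) t)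
    (h3 : ∀ t, HasDerivAt φ₂ (φ₃ t) t) (hM : ∀ t ∈ Icc (0 : ℝ) 1, |φ₃ t| ≤ M) :
    |φ 1 - φ 0 - φ₁ 0 - φ₂ 0 / 2| ≤ M / 2 := by
  have hM0 : 0 ≤ M := (abs_nonneg _).trans (hM 0 (by simp))
  have hG : ∀ s, HasDerivAt (fun s => φ 1 - (φ s + φ₁ s * (1 - s) + φ₂ s * (1 - s) ^ 2 / 2)) (-(φ₃ s * (1 - s) ^ 2 / 2)) s := by
    intro s
    have hl : HasDerivAt (fun s : ℝ => 1 - s) (-1) s := (hasDerivAt_id' s).const_sub 1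
    have hq2 : HasDerivAt (fun s : ℝ => (1 - s) ^ 2) (-(2 * (1 - s))) s := (hl.pow 2).congr_deriv (by norm_num)
    have h := (((h1 s).add ((h2 s).mul hl)).add (((h3 s).mul hq2).div_const 2)).const_sub (φ 1)
    refine h.congr_deriv ?_
    ring
  have hGw : ∀ s ∈ Icc (0 : ℝ) 1, HasDerivWithinAt (fun s => φ 1 - (φ s + φ₁ s * (1 - s) + φ₂ s * (1 - s) ^ 2 / 2))
      (-(φ₃ s * (1 - s) ^ 2 / 2)) (Icc (0 : ℝ) 1) s := fun s _ => (hG s).hasDerivWithinAt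
  have hbound : ∀ s ∈ Icc (0 : ℝ) 1, ‖-(φ₃ s * (1 - s) ^ 2 / 2)‖ ≤ M / 2 := by
    intro s hs
    have h1s : 0 ≤ 1 - s := by linarith [hs.2]
    have hp : (1 - s) ^ 2 ≤ 1 := pow_le_one₀ h1s (by linarith [hs.1])
    have hp0 : 0 ≤ (1 - s) ^ 2 := pow_nonneg h1s 2
    have hφ := hM s hs
    rw [Real.norm_eq_abs, abs_neg, abs_div, abs_mul, abs_of_nonneg hp0, abs_of_pos (by norm_num : (0 : ℝ) < 2)]
    have : |φ₃ s| * (1 - s) ^ 2 ≤ M * 1 := mul_le_mul hφ hp hp0 hM0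
    linarith
  have hmv := (convex_Icc (0 : ℝ) 1).norm_image_sub_le_of_norm_hasDerivWithin_le hGw hbound (right_mem_Icc.2 zero_le_one) (left_mem_Icc.2 zero_le_one)
  have e : |φ 1 - φ 0 - φ₁ 0 - φ₂ 0 / 2| =
      ‖(φ 1 - (φ 0 + φ₁ 0 * (1 - 0) + φ₂ 0 * (1 - 0) ^ 2 / 2)) - (φ 1 - (φ 1 + φ₁ 1 * (1 - 1) + φ₂ 1 * (1 - 1) ^ 2 / 2))‖ := by
    rw [Real.norm_eq_abs]; congr 1; ring
  rw [e]
  refine hmv.trans ?_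
  simp

/-- ★ **THE WITNESSES ARE THE ITERATED DERIVATIVES**: for a chain of derivative witnesses on `ℝ`, `deriv φ = φ₁`, `iteratedDeriv 2 φ = φ₂`,
`iteratedDeriv 3 φ = φ₃`, `iteratedDeriv 4 φ = φ₄`. [folklore] -/
theorem iteratedDeriv_eq_of_hasDerivAt_chain {φ φ₁ φ₂ φ₃ φ₄ : ℝ → ℝ} (h1 : ∀ t, HasDerivAt φ (φ₁ t) t) (h2 : ∀ t, HasDerivAt φ₁ (φ₂ t) t)
    (h3 : ∀ t, HasDerivAt φ₂ (φ₃ t) t) (h4 : ∀ t, HasDerivAt φ₃ (φ₄ t) t) :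
    deriv φ = φ₁ ∧ iteratedDeriv 2 φ = φ₂ ∧ iteratedDeriv 3 φ = φ₃ ∧ iteratedDeriv 4 φ = φ₄ := by
  have e1 : deriv φ = φ₁ := funext fun t => (h1 t).deriv
  have e2 : deriv φ₁ = φ₂ := funext fun t => (h2 t).deriv
  have e3 : deriv φ₂ = φ₃ := funext fun t => (h3 t).deriv
  have e4 : deriv φ₃ = φ₄ := funext fun t => (h4 t).deriv
  have i2 : iteratedDeriv 2 φ = φ₂ := by rw [iteratedDeriv_succ, iteratedDeriv_one, e1, e2]
  have i3 : iteratedDeriv 3 φ = φ₃ := by rw [iteratedDeriv_succ, i2, e3]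
  have i4 : iteratedDeriv 4 φ = φ₄ := by rw [iteratedDeriv_succ, i3, e4]
  exact ⟨e1, i2, i3, i4⟩

/-! ## §2 The W4 datum for the deficit along the Euler rays -/

variable {L : ℕ} [NeZero L]

/-- ★★★ **THE ORDER-4 TAYLOR DATUM OF THE σ-GLUED DEFICIT ALONG AN EULER RAY** (LEAD g97's brick W4): for hub `a ≠ 0`, signs `ε`, coordinates `η` with all
letter sizes `≤ A` (`τ(η.1.1), τ(η.1.2) ≤ A`; `√Σ(η.2.1)ₖ² ≤ A`; `√Σ(η.2.2 i)ₖ² ≤ A`) and `φ t = chartDeficit L z χ (blowUpPoint t (gnomonicPoint a ε η))`: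
the iterated derivatives obey `|φ′| ≤ 720L⁴A`, `|φ″| ≤ 20400L⁴A²`, `|φ‴| ≤ 2484000L⁴A³`, `|φ⁗| ≤ 381240000L⁴A⁴` EVERYWHERE, and the fourth-order Taylor
remainders at `t = 0` satisfy `|φ 1 − φ 0 − φ′ 0 − φ″ 0/2| ≤ 2484000L⁴A³/2` (the CUBIC datum of the `1/√b` core) and
`|φ 1 − φ 0 − φ′ 0 − φ″ 0/2 − φ‴ 0/6| ≤ 381240000L⁴A⁴/6` (the QUARTIC datum of the `1/b` core). [cite: Luscher1983, §2] -/
theorem taylor_four_chartDeficit_gnomonic (z : Fin 3 → Bool) (χ : Site 3 L → SU2) {a : ℍ} (ha : a ≠ 0) (ε : GnoSign L) (η : GnoCoord L) {A : ℝ}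
    (hA : 0 ≤ A) (hx : Real.sqrt ((η.1.1 1 ^ 2 + η.1.1 2 ^ 2) / (1 + η.1.1 0 ^ 2)) ≤ A) (hy : Real.sqrt ((η.1.2 1 ^ 2 + η.1.2 2 ^ 2) / (1 + η.1.2 0 ^ 2)) ≤ A)
    (hz : Real.sqrt (∑ k, η.2.1 k ^ 2) ≤ A) (hf : ∀ i, Real.sqrt (∑ k, η.2.2 i k ^ 2) ≤ A) :
    (∀ t, |deriv (fun t : ℝ => chartDeficit L z χ (blowUpPoint t (gnomonicPoint a ε η))) t| ≤ 720 * (L : ℝ) ^ 4 * A ∧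
        |iteratedDeriv 2 (fun t : ℝ => chartDeficit L z χ (blowUpPoint t (gnomonicPoint a ε η))) t| ≤ 20400 * (L : ℝ) ^ 4 * A ^ 2 ∧
        |iteratedDeriv 3 (fun t : ℝ => chartDeficit L z χ (blowUpPoint t (gnomonicPoint a ε η))) t| ≤ 2484000 * (L : ℝ) ^ 4 * A ^ 3 ∧
        |iteratedDeriv 4 (fun t : ℝ => chartDeficit L z χ (blowUpPoint t (gnomonicPoint a ε η))) t| ≤ 381240000 * (L : ℝ) ^ 4 * A ^ 4) ∧
      |chartDeficit L z χ (blowUpPoint 1 (gnomonicPoint a ε η)) - chartDeficit L z χ (blowUpPoint 0 (gnomonicPoint a ε η)) -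
          deriv (fun t : ℝ => chartDeficit L z χ (blowUpPoint t (gnomonicPoint a ε η))) 0 -
          iteratedDeriv 2 (fun t : ℝ => chartDeficit L z χ (blowUpPoint t (gnomonicPoint a ε η))) 0 / 2| ≤ 2484000 * (L : ℝ) ^ 4 * A ^ 3 / 2 ∧
      |chartDeficit L z χ (blowUpPoint 1 (gnomonicPoint a ε η)) - chartDeficit L z χ (blowUpPoint 0 (gnomonicPoint a ε η)) -
          deriv (fun t : ℝ => chartDeficit L z χ (blowUpPoint t (gnomonicPoint a ε η))) 0 -
          iteratedDeriv 2 (fun t : ℝ => chartDeficit L z χ (blowUpPoint t (gnomonicPoint a ε η))) 0 / 2 -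
          iteratedDeriv 3 (fun t : ℝ => chartDeficit L z χ (blowUpPoint t (gnomonicPoint a ε η))) 0 / 6| ≤
        381240000 * (L : ℝ) ^ 4 * A ^ 4 / 6 := by
  obtain ⟨d₁, d₂, d₃, d₄, h₁, h₂, h₃, h₄, hb⟩ := realJet4_chartDeficit_gnomonic_le z χ ha ε η hA hx hy hz hf
  obtain ⟨e1, e2, e3, e4⟩ := iteratedDeriv_eq_of_hasDerivAt_chain h₁ h₂ h₃ h₄
  refine ⟨fun t => ?_, ?_, ?_⟩
  · rw [e1, e2, e3, e4]; exact hb t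
  · rw [e1, e2]
    exact abs_taylor_three_remainder_le h₁ h₂ h₃ (fun t _ => (hb t).2.2.1)
  · rw [e1, e2, e3]
    exact abs_taylor_four_remainder_le h₁ h₂ h₃ h₄ (fun t _ => (hb t).2.2.2)

/-- ★★ **The same datum read on `F̂(eulerDilate t η)`** (✓`gnoDeficit_eulerDilate`): with `ψ t = gnoDeficit z χ a ε (eulerDilate t η)` one has `ψ = φ`, hence
`|ψ‴| ≤ 2484000L⁴A³`, `|ψ⁗| ≤ 381240000L⁴A⁴` everywhere, `|F̂ η − F̂(eulerDilate 0 η) − ψ′ 0 − ψ″ 0/2| ≤ 2484000L⁴A³/2` and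
`|F̂ η − F̂(eulerDilate 0 η) − ψ′ 0 − ψ″ 0/2 − ψ‴ 0/6| ≤ 381240000L⁴A⁴/6`. [cite: Luscher1983, §2] -/
theorem taylor_four_gnoDeficit (z : Fin 3 → Bool) (χ : Site 3 L → SU2) {a : ℍ} (ha : a ≠ 0) (ε : GnoSign L) (η : GnoCoord L) {A : ℝ}
    (hA : 0 ≤ A) (hx : Real.sqrt ((η.1.1 1 ^ 2 + η.1.1 2 ^ 2) / (1 + η.1.1 0 ^ 2)) ≤ A) (hy : Real.sqrt ((η.1.2 1 ^ 2 + η.1.2 2 ^ 2) / (1 + η.1.2 0 ^ 2)) ≤ A)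
    (hz : Real.sqrt (∑ k, η.2.1 k ^ 2) ≤ A) (hf : ∀ i, Real.sqrt (∑ k, η.2.2 i k ^ 2) ≤ A) :
    (∀ t, |iteratedDeriv 3 (fun t : ℝ => gnoDeficit z χ a ε (eulerDilate t η)) t| ≤ 2484000 * (L : ℝ) ^ 4 * A ^ 3 ∧
        |iteratedDeriv 4 (fun t : ℝ => gnoDeficit z χ a ε (eulerDilate t η)) t| ≤ 381240000 * (L : ℝ) ^ 4 * A ^ 4) ∧
      |gnoDeficit z χ a ε η - gnoDeficit z χ a ε (eulerDilate 0 η) - deriv (fun t : ℝ => gnoDeficit z χ a ε (eulerDilate t η)) 0 -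
          iteratedDeriv 2 (fun t : ℝ => gnoDeficit z χ a ε (eulerDilate t η)) 0 / 2| ≤ 2484000 * (L : ℝ) ^ 4 * A ^ 3 / 2 ∧
      |gnoDeficit z χ a ε η - gnoDeficit z χ a ε (eulerDilate 0 η) - deriv (fun t : ℝ => gnoDeficit z χ a ε (eulerDilate t η)) 0 -
          iteratedDeriv 2 (fun t : ℝ => gnoDeficit z χ a ε (eulerDilate t η)) 0 / 2 -
          iteratedDeriv 3 (fun t : ℝ => gnoDeficit z χ a ε (eulerDilate t η)) 0 / 6| ≤ 381240000 * (L : ℝ) ^ 4 * A ^ 4 / 6 := by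
  have e : (fun t : ℝ => gnoDeficit z χ a ε (eulerDilate t η)) = fun t => chartDeficit L z χ (blowUpPoint t (gnomonicPoint a ε η)) :=
    funext fun t => gnoDeficit_eulerDilate z χ a ε η t
  have e1 : gnoDeficit z χ a ε η = chartDeficit L z χ (blowUpPoint 1 (gnomonicPoint a ε η)) := by
    rw [← gnoDeficit_eulerDilate z χ a ε η 1, eulerDilate_one]
  have e0 : gnoDeficit z χ a ε (eulerDilate 0 η) = chartDeficit L z χ (blowUpPoint 0 (gnomonicPoint a ε η)) := gnoDeficit_eulerDilate z χ a ε η 0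
  obtain ⟨hd, hT3, hT4⟩ := taylor_four_chartDeficit_gnomonic z χ ha ε η hA hx hy hz hf
  rw [e, e1, e0]
  exact ⟨fun t => ⟨(hd t).2.2.1, (hd t).2.2.2⟩, hT3, hT4⟩

end Summit.QuantumFields.YangMills.Theorems.SwapVirialDeficit.Gnomonic

end
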